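import Summits.NavierStokesRegularity.FunctionalMining.Candidates
import HarnessLib

/-!
# FunctionalMining — K1-Q4 typed: vorticity moments under Constantin–Fefferman direction coherence on `T³` (dict seat, staged)

HONEST FRAMING. Search for candidate a priori estimates; no regularity claim. This file TYPES the
dictionary question K1-Q4 (DICTIONARY §14, door D2a+D4, the 26 `T_AH` rows of `dict/K0.json`):
*under the Constantin–Fefferman direction hypothesis `H_CF(Ω, ρ)` along a classical Navier–Stokes
solution on `T³`, are the vorticity moments `Z_q = ∫|ω|^q` (`q = 3, 4`; `q = 2` is the `T³` twin of
CF93 itself) bounded a priori by the initial data?* On `ℝ³` and `q = 2` this is the THEOREM of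
Constantin–Fefferman 1993 (tree, proved: `Literature.Analysis.FluidPDE.exists_uniform_H1_bound_of_direction`,
`constantin_fefferman_holds`); no `T³` twin and no `q > 2` version is in the tree or — per the
literature seat's PINS P5 — in print. Nothing here is proved about Navier–Stokes: the statements are
`@[conjecture] def`s (obligation nodes for the prove seat); the proved lemmas are pointwise algebra
(Cauchy–Schwarz for the vorticity pairing, monotonicity of the hypothesis in `(Ω, ρ)`).

Conventions (generic index type `d`, meaningful at `Fintype.card d = 3`): the vorticity is carried as
the antisymmetric matrix `A(x)ᵢⱼ = (∂ᵢv(x))ⱼ − (∂ⱼv(x))ᵢ`; `torusVorticitySqAt v x = ½∑ᵢⱼAᵢⱼ(x)²`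
(tree) is `|ω(x)|²` and `torusVorticityPairing v x y = ½∑ᵢⱼAᵢⱼ(x)Aᵢⱼ(y)` is `⟪ω(x), ω(y)⟫` at
`d = 3` (the hat map is an isometry up to `√2`). CF's hypothesis `√(1 − ⟪ξ(x),ξ(y)⟫²) ≤ |x − y|/ρ`
for `|ω(x)|, |ω(y)| > Ω` is written squared and division-free with the torus (sup-)distance `dist`.
[cite: ConstantinFeffermanIndiana1993, Theorem (§1); LemarieRieusset2016, Thm. 11.7]
-/

noncomputable section

namespace Summit.NavierStokesRegularity.FunctionalMining

open MeasureTheory Set Literature.Analysis.FunctionSpaces Literature.Analysis.FluidPDE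

variable {d : Type*} [Fintype d] [DecidableEq d]

/-! ### The vorticity pairing `⟪ω(x), ω(y)⟫` in matrix form -/

/-- `⟪ω(x), ω(y)⟫` in generic-`d` matrix form: `½ ∑ᵢⱼ Aᵢⱼ(x) Aᵢⱼ(y)` with `A = ∇v − ∇vᵀ`
(equals the Euclidean pairing of the vorticity vectors at `d = 3`; equals `torusVorticitySqAt v x`
on the diagonal). [ours, bookkeeping] -/
def torusVorticityPairing (v : UnitAddTorus d → EuclideanSpace ℝ d) (x y : UnitAddTorus d) : ℝ :=
  2⁻¹ * ∑ i, ∑ j, ((Torus.partialDeriv i v x) j - (Torus.partialDeriv j v x) i) *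
    ((Torus.partialDeriv i v y) j - (Torus.partialDeriv j v y) i)

/-- On the diagonal the pairing is `|ω(x)|²`. [ours, bookkeeping] -/
theorem torusVorticityPairing_self (v : UnitAddTorus d → EuclideanSpace ℝ d) (x : UnitAddTorus d) :
    torusVorticityPairing v x x = torusVorticitySqAt v x := by
  simp only [torusVorticityPairing, torusVorticitySqAt, sq]

/-- The pairing is symmetric. [ours, bookkeeping] -/
theorem torusVorticityPairing_comm (v : UnitAddTorus d → EuclideanSpace ℝ d) (x y : UnitAddTorus d) :
    torusVorticityPairing v x y = torusVorticityPairing v y x := by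
  simp only [torusVorticityPairing, mul_comm]

/-- **Cauchy–Schwarz for the vorticity pairing**: `⟪ω(x), ω(y)⟫² ≤ |ω(x)|²|ω(y)|²`, so the
"`sin²`" in `TorusDirectionCoherent` is non-negative. [ours, elementary] -/
theorem torusVorticityPairing_sq_le (v : UnitAddTorus d → EuclideanSpace ℝ d) (x y : UnitAddTorus d) :
    torusVorticityPairing v x y ^ 2 ≤ torusVorticitySqAt v x * torusVorticitySqAt v y := by
  set A : d × d → ℝ := fun q => (Torus.partialDeriv q.1 v x) q.2 - (Torus.partialDeriv q.2 v x) q.1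
  set B : d × d → ℝ := fun q => (Torus.partialDeriv q.1 v y) q.2 - (Torus.partialDeriv q.2 v y) q.1
  have hP : torusVorticityPairing v x y = 2⁻¹ * ∑ q, A q * B q := by
    simp only [torusVorticityPairing, A, B, ← Finset.univ_product_univ, Finset.sum_product]
  have hX : torusVorticitySqAt v x = 2⁻¹ * ∑ q, A q ^ 2 := by
    simp only [torusVorticitySqAt, A, ← Finset.univ_product_univ, Finset.sum_product]
  have hY : torusVorticitySqAt v y = 2⁻¹ * ∑ q, B q ^ 2 := by
    simp only [torusVorticitySqAt, B, ← Finset.univ_product_univ, Finset.sum_product]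
  have hCS := Finset.sum_mul_sq_le_sq_mul_sq Finset.univ A B
  rw [hP, hX, hY]
  nlinarith [hCS]

/-! ### The Constantin–Fefferman direction hypothesis on the torus -/

/-- **`H_CF(Ω, ρ)` on `T^d` (squared, division-free).** The vorticity direction is `ρ`-Lipschitz-
coherent where the vorticity is large: for all `x, y` with `|ω(x)|², |ω(y)|² > Ω²`,
`sin²∠(ω(x), ω(y)) = 1 − ⟪ξ(x),ξ(y)⟫² ≤ dist(x,y)²/ρ²`, written as
`ρ²·(|ω(x)|²|ω(y)|² − ⟪ω(x),ω(y)⟫²) ≤ dist(x,y)²·|ω(x)|²|ω(y)|²` (`dist` = the flat-torus sup metric of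
`UnitAddTorus d = d → UnitAddCircle`; equivalent to CF's Euclidean form up to the constant `√d` in
`ρ`). [cite: ConstantinFeffermanIndiana1993, Theorem (§1), hypothesis; tree ℝ³ form: the `hdir`
binder of `Literature.Analysis.FluidPDE.exists_uniform_H1_bound_of_direction`] -/
def TorusDirectionCoherent (v : UnitAddTorus d → EuclideanSpace ℝ d) (Ω ρ : ℝ) : Prop :=
  ∀ x y : UnitAddTorus d, Ω ^ 2 < torusVorticitySqAt v x → Ω ^ 2 < torusVorticitySqAt v y →
    ρ ^ 2 * (torusVorticitySqAt v x * torusVorticitySqAt v y - torusVorticityPairing v x y ^ 2) ≤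
      dist x y ^ 2 * (torusVorticitySqAt v x * torusVorticitySqAt v y)

/-- `H_CF` is monotone: a larger threshold `Ω' ≥ Ω ≥ 0` and a smaller radius `ρ'² ≤ ρ²` give a
weaker hypothesis. [ours, bookkeeping] -/
theorem TorusDirectionCoherent.mono {v : UnitAddTorus d → EuclideanSpace ℝ d} {Ω Ω' ρ ρ' : ℝ}
    (h : TorusDirectionCoherent v Ω ρ) (hΩ0 : 0 ≤ Ω) (hΩ : Ω ≤ Ω') (hρ : ρ' ^ 2 ≤ ρ ^ 2) :
    TorusDirectionCoherent v Ω' ρ' := by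
  intro x y hx hy
  have hΩ2 : Ω ^ 2 ≤ Ω' ^ 2 := pow_le_pow_left₀ hΩ0 hΩ 2
  have hD : 0 ≤ torusVorticitySqAt v x * torusVorticitySqAt v y - torusVorticityPairing v x y ^ 2 :=
    sub_nonneg.mpr (torusVorticityPairing_sq_le v x y)
  exact (mul_le_mul_of_nonneg_right hρ hD).trans (h x y (hΩ2.trans_lt hx) (hΩ2.trans_lt hy))

/-- `H_CF(Ω, ρ)` is vacuous where the vorticity never exceeds `Ω`: a field with `|ω|² ≤ Ω²`
everywhere is coherent for every `ρ`. [ours, bookkeeping] -/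
theorem torusDirectionCoherent_of_vorticitySq_le {v : UnitAddTorus d → EuclideanSpace ℝ d} {Ω ρ : ℝ}
    (h : ∀ x, torusVorticitySqAt v x ≤ Ω ^ 2) : TorusDirectionCoherent v Ω ρ :=
  fun x _ hx _ => absurd hx (not_lt.mpr (h x))

/-! ### K1-Q4 typed -/

/-- **K1-Q4, a priori form — `CFVorticityMomentBound q`** (door D2a+D4; K0 `T_AH` rows of the cores
`E.q=3`, `E.q=4`; `q = 2` is the `T³` twin of CF93). For `d = 3`, every `ν > 0`, every
`Ω, ρ > 0` and every horizon `T > 0` there is a function `G` of the INITIAL kinetic energy and the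
INITIAL moment only such that along every classical Navier–Stokes solution on `[a, b]`,
`b − a ≤ T`, satisfying `H_CF(Ω, ρ)` at every time, `Z_q(u(t)) ≤ G(E(u(a)), Z_q(u(a)))` on
`[a, b]`. (`G` may depend on `ν, Ω, ρ, T, q` through the quantifier order; it may NOT depend on the
solution — that is the content.) OPEN for every `q ≥ 2` on `T³`; on `ℝ³`, `q = 2` is CF93 (tree:
`exists_uniform_H1_bound_of_direction`). The census's `T_AH` rows are energy-line-Grönwall instances
of this shape measured on bank trajectories with the bank's in-situ coherence modulus. Search for
candidate a priori estimates; no regularity claim.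
[cite: ConstantinFeffermanIndiana1993, Theorem (§1); LemarieRieusset2016, Thm. 11.7] -/
@[conjecture] def CFVorticityMomentBound (q : ℝ) : Prop :=
  Fintype.card d = 3 → ∀ {ν : ℝ}, 0 < ν → ∀ {Ω ρ : ℝ}, 0 < Ω → 0 < ρ → ∀ {T : ℝ}, 0 < T →
    ∃ G : ℝ → ℝ → ℝ, ∀ {a b : ℝ}, a < b → b - a ≤ T →
      ∀ {u : ℝ → UnitAddTorus d → EuclideanSpace ℝ d} {p : ℝ → UnitAddTorus d → ℝ},
        Torus.IsClassicalNSSolutionOn (Icc a b) ν 0 u p →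
        (∀ t ∈ Icc a b, TorusDirectionCoherent (u t) Ω ρ) →
        ∀ t ∈ Icc a b, torusVorticityMoment q (u t) ≤
          G (Torus.kineticEnergy (u a)) (torusVorticityMoment q (u a))

/-- **The unconditional comparison statement — `VorticityMomentAPrioriBound q`**: the same a priori
bound WITHOUT the direction hypothesis (for `q = 2` on `T³` this is an a priori enstrophy bound by the
initial energy and enstrophy, i.e. regularity-strength; recorded only so that the implication below
can be stated — it is NOT claimed). [ours, bookkeeping] -/
@[conjecture] def VorticityMomentAPrioriBound (q : ℝ) : Prop :=
  Fintype.card d = 3 → ∀ {ν : ℝ}, 0 < ν → ∀ {T : ℝ}, 0 < T →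
    ∃ G : ℝ → ℝ → ℝ, ∀ {a b : ℝ}, a < b → b - a ≤ T →
      ∀ {u : ℝ → UnitAddTorus d → EuclideanSpace ℝ d} {p : ℝ → UnitAddTorus d → ℝ},
        Torus.IsClassicalNSSolutionOn (Icc a b) ν 0 u p →
        ∀ t ∈ Icc a b, torusVorticityMoment q (u t) ≤
          G (Torus.kineticEnergy (u a)) (torusVorticityMoment q (u a))

/-- The unconditional bound trivially implies the conditional one (K1-Q4 is WEAKER than an a priori
`Z_q` bound; the question is whether `H_CF` closes the gap for `q > 2` as it does for `q = 2` on
`ℝ³`). [ours, bookkeeping] -/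
theorem cfVorticityMomentBound_of_aPriori {q : ℝ}
    (h : VorticityMomentAPrioriBound (d := d) q) : CFVorticityMomentBound (d := d) q := by
  intro hd ν hν Ω ρ _ _ T hT
  obtain ⟨G, hG⟩ := h hd hν hT
  exact ⟨G, fun hab hT' u p hsol _ t ht => hG hab hT' hsol t ht⟩

end Summit.NavierStokesRegularity.FunctionalMining

end
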